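import Mathlib
import Literature.Geometry.DiscreteGeometry.BondGraph
import Literature.MathematicalPhysics.StatisticalMechanics.BarlowStacking
import Literature.MathematicalPhysics.StatisticalMechanics.PeriodicConfigurationSums
import Summits.AtomisticToContinuum.Crystallization.Theorems.ChargedEnergyGap.Negative.PeriodicForm
import Summits.AtomisticToContinuum.Crystallization.Theorems.PricedLinkCensusChargedEnergyGapGrossFloorOfPeriodic
import HarnessLib

/-!
# Line `barlow-relative-pricing` (crux `PricedLinkCensus.ChargedEnergyGap`,
# stmt-AtomisticToContinuum-14231): periodic perturbative pricing implies the finite one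

Stub `stub_perturbativeOfPeriodic` of the line skeleton: the TRANSFER of the perturbative
(two-resolution) pricing from periodic configurations to finite separated ones.  A site `i` of a
configuration `y : ι → ℝ³` is `(ε, 3)`-BARLOW-NEAR (`near ε ι y i` in the signature) if its
nearest-neighbour distance `a = nn_i` (`Literature.Geometry.DiscreteGeometry.nearestDist`) is
positive, the sites within `3a` of `y i` are pairwise `a/2`-separated, and they are two-way
`ε·a`-matched inside that ball with a rigid image `g '' barlowStacking a (a√(2/3)) s` of an ideal
Barlow stacking (`g` an affine isometry of `ℝ³`, `s` a Hägg word).  FINE = `(1/40, 3)`-near but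
not `(1/500, 3)`-near, GROSS = not `(1/40, 3)`-near.  HYPOTHESIS (periodic perturbative pricing,
the open neighbouring stub `stub_perturbativePeriodic`): some `c > 0` and `C'` price every periodic
configuration `Q` of `ℝ³` by `c·#fine(Q) − C'·#gross(Q) ≤ #motif · (e(Q) − e_B)`, the motif
points being classified by nearness in the infinite point set `Q.points`, `e_B` the Barlow
reference energy (an opaque real here).  CONCLUSION: for every `δ₀ > 0` there are `c > 0`, `c'`,
`C` with `N·e_B + c·#{i not (1/500,3)-near in y} − c'·#{i not (1/40,3)-near in y} − C·N^(2/3)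
≤ E(y)` for every `δ₀`-separated `y : Fin N → ℝ³` (`E` the finite Lennard-Jones energy).

Proof (the landed `BarlowRelativePricingPeriodic.floor_of_periodic` with a second, oppositely
signed count).  Take the same `c`, `c' = c + |C'|`, `C = c + max e_B 0`.  For `N ≤ 1` the energy
vanishes and the counts are at most `N`, absorbed by `C·N^(2/3)` (`c' ≥ 0`).  For `N ≥ 2`
(separation gives injectivity) periodise `y` far apart, `Q = periodiseFar y` (period `8D + 8`):
`N·e(Q) ≤ E(y)` (`energyPerParticle_periodise_le`), `#motif = N`, and at the motif points `yᵢ`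
nearness in `Q.points` IS nearness in `y` at both resolutions (`near_of_near_image`,
`near_image_of_near`: `nearestDist_toPoint`, and a point of `Q.points` within `(3 + ε)·nn_i ≤ 6D`
of `yᵢ` is a motif point, `exists_toPoint_eq_of_dist_le_mul`), so `#fine(Q) = #fine(y)` and
`#gross(Q) = #gross(y)` (`card_motif_periodiseFar`).  Pointwise a site that is not
`(1/500,3)`-near is fine or gross, `#nonNear₅₀₀(y) ≤ #fine(y) + #gross(y)`, whence
`c·#nonNear₅₀₀(y) − (c + |C'|)·#gross(y) ≤ c·#fine(Q) − C'·#gross(Q) ≤ N·(e(Q) − e_B) ≤ E(y) − N·e_B`.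
The assembly `floor₂_of_periodic` is stated for an arbitrary reference `e` and arbitrary predicate
pairs `(P₁, p₁)`, `(P₂, p₂)` (periodic / finite) that agree at motif points of far periodisations.
All `[folklore]`.
-/

noncomputable section

namespace Summit.AtomisticToContinuum.Crystallization.Theorems.BarlowRelativePricingPerturbativeTransfer

open scoped BigOperators
open Literature.MathematicalPhysics.StatisticalMechanics Literature.Geometry.DiscreteGeometry
open Summit.AtomisticToContinuum.Crystallization.Theorems.ChargedEnergyGapNegative
open Summit.AtomisticToContinuum.Crystallization.Theorems.BarlowRelativePricingPeriodic

/-! ## Counting -/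

/-- A non-`q` element is either (`p` and not `q`) or not `p`:
`#{¬q} ≤ #{p ∧ ¬q} + #{¬p}` on a finite type. [folklore] -/
theorem card_not_le_card_add {α : Type*} [Finite α] (p q : α → Prop) :
    Nat.card {a // ¬ q a} ≤ Nat.card {a // p a ∧ ¬ q a} + Nat.card {a // ¬ p a} := by
  classical
  have := Fintype.ofFinite α
  have hle : ∀ a, ¬ q a → (p a ∧ ¬ q a) ∨ ¬ p a := fun a ha => by
    by_cases hp : p a
    exacts [Or.inl ⟨hp, ha⟩, Or.inr hp]
  simp only [Nat.card_eq_fintype_card]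
  calc Fintype.card {a // ¬ q a} ≤ Fintype.card {a // (p a ∧ ¬ q a) ∨ ¬ p a} :=
        Fintype.card_le_of_injective (fun a => ⟨a.1, hle a.1 a.2⟩)
          (fun a b hab => Subtype.ext (Subtype.mk.inj hab))
    _ ≤ Fintype.card {a // p a ∧ ¬ q a} + Fintype.card {a // ¬ p a} :=
        Fintype.card_subtype_or (fun a => p a ∧ ¬ q a) (fun a => ¬ p a)

/-- **Counting motif points of the far periodisation through `y`.**  If a predicate `P` on the
motif `{yᵢ}` of `periodiseFar y` (`y` injective) agrees with `p` on `Fin N` at every `yᵢ`, then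
`#{x ∈ motif : P x} = #{i : p i}` (the map `i ↦ yᵢ` is a bijection onto the motif). [folklore] -/
theorem card_motif_periodiseFar {N : ℕ} {y : Fin N → E3} (hy : Function.Injective y) (hN : 0 < N)
    {P : (periodiseFar y hN).motif → Prop} {p : Fin N → Prop}
    (h : ∀ i, P ⟨y i, mem_motif_periodiseFar y hN i⟩ ↔ p i) :
    Nat.card {x : (periodiseFar y hN).motif // P x} = Nat.card {i : Fin N // p i} := by
  let f : {i : Fin N // p i} → {x : (periodiseFar y hN).motif // P x} :=
    fun i => ⟨⟨y i.1, mem_motif_periodiseFar y hN i.1⟩, (h i.1).2 i.2⟩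
  have hf : Function.Bijective f := by
    constructor
    · intro a b hab
      have : y a.1 = y b.1 := congrArg (fun z => ((z.1 : (periodiseFar y hN).motif) : E3)) hab
      exact Subtype.ext (hy this)
    · rintro ⟨⟨v, hv⟩, hc⟩
      have hv' := hv
      rw [motif_periodiseFar] at hv'
      obtain ⟨i, -, rfl⟩ := Finset.mem_image.1 hv'
      exact ⟨⟨i, (h i).1 hc⟩, rfl⟩
  exact (Nat.card_congr (Equiv.ofBijective f hf)).symm

/-! ## Energy -/

/-- **The case `N ≥ 1`, `y` injective.**  Periodic two-count pricing
`c·#{P₁ ∧ ¬P₂} − C'·#{¬P₁} ≤ #motif·(e(Q) − e)` at the far periodisation `Q = y + (8D+8)ℤ³`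
gives `N·e + c·#{¬p₂} − (c + |C'|)·#{¬p₁} ≤ E(y)` as soon as `Pₖ` (read in `Q`) agrees with `pₖ`
at every motif point `yᵢ` (`#motif = N`, `N·e(Q) ≤ E(y)`, `#{¬p₂} ≤ #{p₁ ∧ ¬p₂} + #{¬p₁}`).
[folklore] -/
theorem floor₂_of_injective {e c C' : ℝ} (hc : 0 < c)
    {P₁ P₂ : (Q : PeriodicConfiguration 3) → Q.motif → Prop}
    (hP : ∀ Q : PeriodicConfiguration 3,
      c * (Nat.card {x : Q.motif // P₁ Q x ∧ ¬ P₂ Q x} : ℝ) -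
          C' * (Nat.card {x : Q.motif // ¬ P₁ Q x} : ℝ) ≤
        (Q.motif.card : ℝ) * (Q.energyPerParticle lennardJones - e))
    {N : ℕ} (hN0 : 0 < N) {y : Fin N → E3} (hy : Function.Injective y) {p₁ p₂ : Fin N → Prop}
    (h₁ : ∀ i, P₁ (periodiseFar y hN0) ⟨y i, mem_motif_periodiseFar y hN0 i⟩ ↔ p₁ i)
    (h₂ : ∀ i, P₂ (periodiseFar y hN0) ⟨y i, mem_motif_periodiseFar y hN0 i⟩ ↔ p₂ i) :
    (N : ℝ) * e + c * (Nat.card {i : Fin N // ¬ p₂ i} : ℝ) -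
        (c + |C'|) * (Nat.card {i : Fin N // ¬ p₁ i} : ℝ) ≤ interactionEnergy lennardJones y := by
  have hp := hP (periodiseFar y hN0)
  have hcard : (((periodiseFar y hN0).motif.card : ℕ) : ℝ) = N := by
    rw [motif_periodiseFar, Finset.card_image_of_injective _ hy, Finset.card_univ,
      Fintype.card_fin]
  have hfine : Nat.card {x : (periodiseFar y hN0).motif //
      P₁ (periodiseFar y hN0) x ∧ ¬ P₂ (periodiseFar y hN0) x} =
        Nat.card {i : Fin N // p₁ i ∧ ¬ p₂ i} :=
    card_motif_periodiseFar hy hN0 fun i => and_congr (h₁ i) (not_congr (h₂ i))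
  have hgross : Nat.card {x : (periodiseFar y hN0).motif // ¬ P₁ (periodiseFar y hN0) x} =
      Nat.card {i : Fin N // ¬ p₁ i} :=
    card_motif_periodiseFar hy hN0 fun i => not_congr (h₁ i)
  rw [hcard, hfine, hgross] at hp
  have hsplit : (Nat.card {i : Fin N // ¬ p₂ i} : ℝ) ≤
      (Nat.card {i : Fin N // p₁ i ∧ ¬ p₂ i} : ℝ) + (Nat.card {i : Fin N // ¬ p₁ i} : ℝ) := by
    exact_mod_cast card_not_le_card_add p₁ p₂
  have hc1 := mul_le_mul_of_nonneg_left hsplit hc.le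
  have hC' : C' * (Nat.card {i : Fin N // ¬ p₁ i} : ℝ) ≤
      |C'| * (Nat.card {i : Fin N // ¬ p₁ i} : ℝ) :=
    mul_le_mul_of_nonneg_right (le_abs_self C') (Nat.cast_nonneg _)
  have hNr : (0 : ℝ) < N := by exact_mod_cast hN0
  have he := energyPerParticle_periodise_le hy (spacingUnit y) (period_le_spacing y) hN0
  rw [le_div_iff₀ hNr, mul_comm] at he
  have he' : (N : ℝ) * (periodiseFar y hN0).energyPerParticle lennardJones ≤
      interactionEnergy lennardJones y := he
  linarith

/-- **Assembly**: the perturbative floor with `c' = c + |C'|`, `C = c + max e 0` on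
`δ₀`-separated configurations, from the periodic two-count pricing (`hP`) and the agreement of
`Pₖ`-in-`Q` with `pₖ`-in-`y` at motif points of far periodisations of injective configurations
with `N ≥ 2` (`h₁`, `h₂`); `N ≤ 1` is the energy-free case. [folklore] -/
theorem floor₂_of_periodic {e c C' : ℝ} (hc : 0 < c)
    {P₁ P₂ : (Q : PeriodicConfiguration 3) → Q.motif → Prop}
    (hP : ∀ Q : PeriodicConfiguration 3,
      c * (Nat.card {x : Q.motif // P₁ Q x ∧ ¬ P₂ Q x} : ℝ) -
          C' * (Nat.card {x : Q.motif // ¬ P₁ Q x} : ℝ) ≤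
        (Q.motif.card : ℝ) * (Q.energyPerParticle lennardJones - e))
    {p₁ p₂ : ∀ {N : ℕ}, (Fin N → E3) → Fin N → Prop}
    (h₁ : ∀ (N : ℕ) (hN0 : 0 < N) (y : Fin N → E3), Function.Injective y →
      (∀ i : Fin N, ∃ j, j ≠ i) →
        ∀ i, P₁ (periodiseFar y hN0) ⟨y i, mem_motif_periodiseFar y hN0 i⟩ ↔ p₁ y i)
    (h₂ : ∀ (N : ℕ) (hN0 : 0 < N) (y : Fin N → E3), Function.Injective y →
      (∀ i : Fin N, ∃ j, j ≠ i) →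
        ∀ i, P₂ (periodiseFar y hN0) ⟨y i, mem_motif_periodiseFar y hN0 i⟩ ↔ p₂ y i)
    (δ₀ : ℝ) (hδ₀ : 0 < δ₀) :
    ∃ c : ℝ, 0 < c ∧ ∃ c' C : ℝ, ∀ (N : ℕ) (y : Fin N → E3),
      (∀ i j : Fin N, i ≠ j → δ₀ ≤ dist (y i) (y j)) →
        (N : ℝ) * e + c * (Nat.card {i : Fin N // ¬ p₂ y i} : ℝ) -
            c' * (Nat.card {i : Fin N // ¬ p₁ y i} : ℝ) - C * (N : ℝ) ^ (2 / 3 : ℝ) ≤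
          interactionEnergy lennardJones y := by
  refine ⟨c, hc, c + |C'|, c + max e 0, fun N y hsep => ?_⟩
  rcases Nat.lt_or_ge N 2 with hN | hN
  · interval_cases N
    · have h0 : Nat.card {i : Fin 0 // ¬ p₂ y i} = 0 := Nat.card_of_isEmpty
      have h0' : Nat.card {i : Fin 0 // ¬ p₁ y i} = 0 := Nat.card_of_isEmpty
      rw [interactionEnergy_of_subsingleton, h0, h0', Nat.cast_zero, Real.zero_rpow (by norm_num)]
      simp
    · have h1 : (Nat.card {i : Fin 1 // ¬ p₂ y i} : ℝ) ≤ 1 := by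
        exact_mod_cast (Finite.card_subtype_le _).trans_eq (Nat.card_fin 1)
      have h1' : (0 : ℝ) ≤ (c + |C'|) * (Nat.card {i : Fin 1 // ¬ p₁ y i} : ℝ) :=
        mul_nonneg (add_nonneg hc.le (abs_nonneg C')) (Nat.cast_nonneg _)
      rw [interactionEnergy_of_subsingleton, Nat.cast_one, one_mul, Real.one_rpow, mul_one]
      linarith [mul_le_of_le_one_right hc.le h1, le_max_left e 0]
  · have hN0 : 0 < N := by omega
    have hy : Function.Injective y := fun i j hij => by
      by_contra hne
      have := hsep i j hne
      rw [hij, dist_self] at this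
      linarith
    have hN2 : ∀ i : Fin N, ∃ j, j ≠ i := exists_ne_of_two_le hN
    have hmain := floor₂_of_injective hc hP hN0 hy (h₁ N hN0 y hy hN2) (h₂ N hN0 y hy hN2)
    have hC : 0 ≤ (c + max e 0) * (N : ℝ) ^ (2 / 3 : ℝ) :=
      mul_nonneg (add_nonneg hc.le (le_max_right e 0)) (Real.rpow_nonneg (Nat.cast_nonneg N) _)
    linarith

/-! ## The stub -/

/-- **stub_perturbativeOfPeriodic** (line `barlow-relative-pricing`): PERIODIC PERTURBATIVE PRICING
IMPLIES THE PERTURBATIVE FLOOR on `δ₀`-separated finite configurations.  With `near ε ι y i` the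
`(ε, 3)`-Barlow-nearness of site `i` in `y : ι → ℝ³` and `e_B` the Barlow reference energy (the
infimum of the Lennard-Jones energy per particle over the periodic Barlow stackings): if some
`c > 0`, `C'` price every periodic configuration `Q` of `ℝ³` by
`c · #{motif points (1/40,3)-near but not (1/500,3)-near in Q.points} −
C' · #{motif points not (1/40,3)-near in Q.points} ≤ #motif · (e(Q) − e_B)`, then for every
`δ₀ > 0` there are `c > 0`, `c'`, `C` with
`N·e_B + c·#{i not (1/500,3)-near in y} − c'·#{i not (1/40,3)-near in y} − C·N^(2/3) ≤ E(y)` for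
all `δ₀`-separated `y : Fin N → ℝ³`.  Proof: `floor₂_of_periodic` with, at both resolutions
`ε ∈ {1/40, 1/500}`, the two transfers `near_of_near_image` / `near_image_of_near` at the motif
points `toPoint y _ i` of the far periodisation (`nearestDist_toPoint`,
`exists_toPoint_eq_of_dist_le_mul` with `3 + ε ≤ 6`). [folklore] -/
theorem stub_perturbativeOfPeriodic : let near : ℝ → (ι : Type) → (ι → EuclideanSpace ℝ (Fin 3)) → ι → Prop := fun ε ι y i => 0 < Literature.Geometry.DiscreteGeometry.nearestDist y i ∧ (∀ j k : ι, j ≠ k → dist (y i) (y j) ≤ 3 * Literature.Geometry.DiscreteGeometry.nearestDist y i → dist (y i) (y k) ≤ 3 * Literature.Geometry.DiscreteGeometry.nearestDist y i → Literature.Geometry.DiscreteGeometry.nearestDist y i / 2 ≤ dist (y j) (y k)) ∧ ∃ (s : ℤ → ℤ) (g : EuclideanSpace ℝ (Fin 3) ≃ᵃⁱ[ℝ] EuclideanSpace ℝ (Fin 3)), Literature.MathematicalPhysics.StatisticalMechanics.IsHaggSeq s ∧ (∀ j : ι, dist (y i) (y j) ≤ 3 * Literature.Geometry.DiscreteGeometry.nearestDist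 y i → ∃ z ∈ Literature.MathematicalPhysics.StatisticalMechanics.barlowStacking (Literature.Geometry.DiscreteGeometry.nearestDist y i) (Literature.Geometry.DiscreteGeometry.nearestDist y i * Real.sqrt (2 / 3)) s, dist (y j) (g z) ≤ ε * Literature.Geometry.DiscreteGeometry.nearestDist y i) ∧ (∀ z ∈ Literature.MathematicalPhysics.StatisticalMechanics.barlowStacking (Literature.Geometry.DiscreteGeometry.nearestDist y i) (Literature.Geometry.DiscreteGeometry.nearestDist y i * Real.sqrt (2 / 3)) s, dist (y i) (g z) ≤ 3 * Literature.Geometry.DiscreteGeometry.nearestDist y i → ∃ j : ι, dist (y j) (g z) ≤ ε * Literature.Geometry.DiscreteGeometry.nearestDist y i); let eB : ℝ := ⨅ P : {t : ℝ × ℝ × ℕ × (ℤ → ℤ) // t.1 ≠ 0 ∧ t.2.1 ≠ 0 ∧ t.2.2.1 ≠ 0 ∧ (∀ i : ℤ, t.2.2.2 (i + t.2.2.1) = t.2.2.2 i) ∧ Literature.MathematicalPhysics.StatisticalMechanics.IsHaggSeq t.2.2.2}, (Literature.MathematicalPhysics.StatisticalMechanics.barlowPeriodicConfiguration P.1.2.2.2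 P.2.1 P.2.2.1 P.2.2.2.1 P.2.2.2.2.1).energyPerParticle Literature.MathematicalPhysics.StatisticalMechanics.lennardJones; (∃ c : ℝ, 0 < c ∧ ∃ C' : ℝ, ∀ Q : Literature.MathematicalPhysics.StatisticalMechanics.PeriodicConfiguration 3, c * (Nat.card {x : Q.motif // near (1 / 40) Q.points (Subtype.val : Q.points → EuclideanSpace ℝ (Fin 3)) ⟨x.1, Q.mem_points_of_mem_motif x.2⟩ ∧ ¬ near (1 / 500) Q.points (Subtype.val : Q.points → EuclideanSpace ℝ (Fin 3)) ⟨x.1, Q.mem_points_of_mem_motif x.2⟩} : ℝ) - C' * (Nat.card {x : Q.motif // ¬ near (1 / 40) Q.points (Subtype.val : Q.points → EuclideanSpace ℝ (Fin 3)) ⟨x.1, Q.mem_points_of_mem_motif x.2⟩} : ℝ) ≤ (Q.motif.card : ℝ) * (Q.energyPerParticle Literature.MathematicalPhysics.StatisticalMechanics.lennardJones - eB)) → ∀ δ₀ : ℝ, 0 < δ₀ → ∃ c : ℝ, 0 < c ∧ ∃ c' C : ℝ, ∀ (N : ℕ) (y : Fin N → EuclideanSpace ℝ (Fin 3)), (∀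 i j : Fin N, i ≠ j → δ₀ ≤ dist (y i) (y j)) → (N : ℝ) * eB + c * (Nat.card {i : Fin N // ¬ near (1 / 500) (Fin N) y i} : ℝ) - c' * (Nat.card {i : Fin N // ¬ near (1 / 40) (Fin N) y i} : ℝ) - C * (N : ℝ) ^ (2 / 3 : ℝ) ≤ Literature.MathematicalPhysics.StatisticalMechanics.interactionEnergy Literature.MathematicalPhysics.StatisticalMechanics.lennardJones y := by
  intro near eB hP δ₀ hδ₀
  obtain ⟨c, hc, C', hP⟩ := hP
  exact floor₂_of_periodic hc
    (P₁ := fun Q x => near (1 / 40) Q.points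
      (Subtype.val : Q.points → EuclideanSpace ℝ (Fin 3)) ⟨x.1, Q.mem_points_of_mem_motif x.2⟩)
    (P₂ := fun Q x => near (1 / 500) Q.points
      (Subtype.val : Q.points → EuclideanSpace ℝ (Fin 3)) ⟨x.1, Q.mem_points_of_mem_motif x.2⟩)
    hP (p₁ := fun {N} y i => near (1 / 40) (Fin N) y i)
    (p₂ := fun {N} y i => near (1 / 500) (Fin N) y i)
    (fun N hN0 y hy hN2 i =>
      ⟨fun h => near_of_near_image (toPoint_injective hy hN0) (val_toPoint y hN0)
          (nearestDist_toPoint hy hN0 (hN2 i))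
          (exists_toPoint_eq_of_dist_le_mul hN0 (hN2 i) (K := 3 + 1 / 40) (by norm_num)) h,
        fun h => near_image_of_near (f := toPoint y hN0) (val_toPoint y hN0)
          (nearestDist_toPoint hy hN0 (hN2 i)) (by norm_num)
          (exists_toPoint_eq_of_dist_le_mul hN0 (hN2 i) (K := 3 + 1 / 40) (by norm_num)) h⟩)
    (fun N hN0 y hy hN2 i =>
      ⟨fun h => near_of_near_image (toPoint_injective hy hN0) (val_toPoint y hN0)
          (nearestDist_toPoint hy hN0 (hN2 i))
          (exists_toPoint_eq_of_dist_le_mul hN0 (hN2 i) (K := 3 + 1 / 500) (by norm_num)) h,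
        fun h => near_image_of_near (f := toPoint y hN0) (val_toPoint y hN0)
          (nearestDist_toPoint hy hN0 (hN2 i)) (by norm_num)
          (exists_toPoint_eq_of_dist_le_mul hN0 (hN2 i) (K := 3 + 1 / 500) (by norm_num)) h⟩)
    δ₀ hδ₀

end Summit.AtomisticToContinuum.Crystallization.Theorems.BarlowRelativePricingPerturbativeTransfer

end
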